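/- Fleet seat `ym-wcr-19608-p2` (g2), route `WeakCouplingRates`, cruxes `ColdBoxTwoPointFloorW` (stmt-QuantumFields-19608) and
`BulkDominatesColdBoxW` (stmt-QuantumFields-19609): the ϑ-DATUM pass of the one-scale trunk, OBJECTS. -/
import Summits.QuantumFields.YangMills.Theorems.WeakCouplingRatesColdBoxOneScaleDefs
import Summits.QuantumFields.YangMills.Theorems.WeakCouplingRatesBulkDominatesColdBoxWDatumShiftIntegral

/-!
# The one-scale expansion WITH AN EXTERIOR DATUM: the objects (ϑ-twins of `…ColdBoxOneScaleDefs`)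

The flat one-scale expansion (`…ColdBoxOneScaleDefs`, `…ColdBoxRepresentation`, `…ColdBoxTiltBound`; fleet lead `ym-wcr-19456-p1` g2)
compares the cold-wall box state conditioned on the small-field event with the product Dirichlet Gaussian `boxDirichlet H ^{⊗3}`.  The crux
`BulkDominatesColdBoxW` (interfaces `KernelMeanExpansion` / `KernelCovExpansion`, `…BulkDominatesColdBoxWDefs`) needs the same expansion for
the DLR box kernel `boxKernel β H W` with a SMALL EXTERIOR DATUM `W`: off the cold box `Λ = boxEdges 4 (2H+1)` the links are chart points
`W e = P(1, ϑ_e)`, `ϑ_e ∈ ℝ³` small, and `ϑ = 0` on the temporal forest.  In the temporal-forest gauge the quadratic part of the action is then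
the pinned lattice Maxwell form `M_{ϑ'_c}` of the enlarged box with the (scaled, `ϑ' = √(2β)ϑ`) datum as pinned values, whose Gaussian is the
TRANSLATE of D1' by the harmonic mean shift `μ'_c = mean ϑ'_c` (`…DatumShiftIntegral`).  This file fixes the objects of the datum pass — the
critic's typed proposal (stub-critic `ym-scrit-goodBoundaryCovStable`, STUB-PLAN rev 2 §T1, evidence #34/#35 on stmt-QuantumFields-19609)
VERBATIM, in the namespace of the flat objects:

* `extDatum ϑ w` — free-link data `w` extended by `0` on the temporal forest and by the datum `ϑ` off the cold box
  (`extDatum 0 w = extZero w`);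
* `sdat β ϑ c = √(2β) • ϑ c` — the scaled datum (Dirichlet units), colour by colour; `meanT H β ϑ : TSpace H` — the colour triple of
  harmonic mean shifts `(mean (sdat β ϑ c))_c`;
* `chartCfgD ϑ w` — the chart configuration of free-link data `w` with exterior datum `ϑ` (ϑ-twin of `chartCfg w`; it IS the glued
  configuration `glueWith Λ (coldExt₁ (P(1,w_·))) W` when `W = P(1, ϑ_·)` off the box: `glueWith_coldExt₁_gnomonicChart`);
  `cfgTD H β ϑ t = chartCfgD ϑ ((t + μ')/√(2β))` — **the chart configuration with datum** of the CENTRED colour triple `t`: free links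
  `P(1, (t + μ')_e/√(2β))`, forest links `1`, exterior links `P(1, ϑ_e)` (the mean shift sits INSIDE the configuration; the Gaussian
  reference stays the unshifted `gauss3 H`); `cfgTD H β 0 = cfgT H β`;
* `qObsD H β ϑ p t = ½ Σ_c sCirc(glue ϑ'_c (mean ϑ'_c + t_c))(p)²` — the quadratic surrogate of `β·cost_p` with datum (literally the
  observable of `integral_quadObs_datum_eq` / `cov_quadObs_datum_eq` at the scaled datum); `qObsD H β 0 = qObs H`;
* `goodTD H β ε ϑ` — the small-field event read in the centred variables; `tiltWD H β ϑ` — the tilt exponent with datum (cubic remainder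
  over the plaquettes touching `Λ` + gnomonic log-Jacobian over the FREE links); both reduce to `goodT` / `tiltW` at `ϑ = 0`;
* elementary API (values on free / forest / exterior edges) and measurability.
Definitions + elementary lemmas only; no analysis.  No sorry; standard axioms.  NOT a claim about the mass gap.
-/

set_option autoImplicit false

noncomputable section

open MeasureTheory Finset
open Literature.Probability.LatticeModels (Site)
open Literature.MathematicalPhysics.QuantumLattice
open Literature.MathematicalPhysics.QuantumFieldTheory
open Literature.MathematicalPhysics.QuantumFieldTheory.LatticeMaxwell
open Literature.MathematicalPhysics.QuantumFieldTheory.AxialGauge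

namespace Summit.QuantumFields.YangMills.Theorems.WeakCouplingRates

variable {H : ℕ}

/-! ## Extension of free-link data by the exterior datum -/

/-- **Free-link data extended by a datum**: `w` on the free links of the cold box `Λ = boxEdges 4 (2H+1)`, `0` on the temporal forest,
and the exterior datum `ϑ` off `Λ`.  At `ϑ = 0` this is `extZero w`. -/
def extDatum {V : Type*} [Zero V] (ϑ : Literature.MathematicalPhysics.QuantumLattice.ZdEdge 4 → V) (w : ColdFreeIdx H → V) :
    Literature.MathematicalPhysics.QuantumLattice.ZdEdge 4 → V := fun e =>
  if h : e ∈ boxEdges 4 (2 * H + 1) then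
    (if hf : (e.2 = 0 ∧ ∀ k : Fin 4, 1 ≤ e.1 k ∧ e.1 k + 1 ≤ 2 * (H : ℤ)) then 0 else w ⟨⟨e, h⟩, hf⟩)
  else ϑ e

/-- The flat datum gives back `extZero`. -/
theorem extDatum_zero {V : Type*} [Zero V] (w : ColdFreeIdx H → V) :
    extDatum (H := H) (0 : Literature.MathematicalPhysics.QuantumLattice.ZdEdge 4 → V) w = extZero w := by
  funext e; simp only [extDatum, extZero, Pi.zero_apply]

/-- `extDatum ϑ w` on a free link. -/
@[simp] theorem extDatum_apply_free {V : Type*} [Zero V] (ϑ : Literature.MathematicalPhysics.QuantumLattice.ZdEdge 4 → V)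
    (w : ColdFreeIdx H → V) (e : ColdFreeIdx H) : extDatum ϑ w e.1.1 = w e := by
  obtain ⟨⟨e, he⟩, hf⟩ := e
  unfold extDatum
  rw [dif_pos he, dif_neg hf]

/-- `extDatum ϑ w` off the cold box is the datum. -/
theorem extDatum_of_not_mem {V : Type*} [Zero V] (ϑ : Literature.MathematicalPhysics.QuantumLattice.ZdEdge 4 → V)
    (w : ColdFreeIdx H → V) {e : Literature.MathematicalPhysics.QuantumLattice.ZdEdge 4} (he : e ∉ boxEdges 4 (2 * H + 1)) :
    extDatum ϑ w e = ϑ e := by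
  simp [extDatum, he]

/-- `extDatum ϑ w` on a forest link is `0`. -/
theorem extDatum_of_forest {V : Type*} [Zero V] (ϑ : Literature.MathematicalPhysics.QuantumLattice.ZdEdge 4 → V)
    (w : ColdFreeIdx H → V) {x : Site 4} (hx : ∀ k : Fin 4, 1 ≤ x k ∧ x k + 1 ≤ 2 * (H : ℤ)) :
    extDatum (H := H) ϑ w (x, 0) = 0 := by
  have hmem : (x, (0 : Fin 4)) ∈ boxEdges 4 (2 * H + 1) := by
    rw [mem_boxEdges_iff]
    exact ⟨fun k => by have := hx k; constructor <;> push_cast <;> omega, by have := hx 0; push_cast; omega⟩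
  unfold extDatum
  rw [dif_pos hmem, dif_pos ⟨rfl, hx⟩]

/-- `extDatum ϑ w` on an edge of the cold box (free or forest) does not read the datum: it is `extZero w` there. -/
theorem extDatum_of_mem {V : Type*} [Zero V] (ϑ : Literature.MathematicalPhysics.QuantumLattice.ZdEdge 4 → V)
    (w : ColdFreeIdx H → V) {e : Literature.MathematicalPhysics.QuantumLattice.ZdEdge 4} (he : e ∈ boxEdges 4 (2 * H + 1)) :
    extDatum ϑ w e = extZero w e := by
  unfold extDatum extZero
  rw [dif_pos he, dif_pos he]

/-- Componentwise reading: `extDatum ϑ w e i = extDatum (ϑ · i) (w · i) e`. -/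
theorem extDatum_apply_pi {ι : Type*} {V : Type*} [Zero V] (ϑ : Literature.MathematicalPhysics.QuantumLattice.ZdEdge 4 → ι → V)
    (w : ColdFreeIdx H → ι → V) (e : Literature.MathematicalPhysics.QuantumLattice.ZdEdge 4) (i : ι) :
    extDatum ϑ w e i = extDatum (fun f => ϑ f i) (fun f => w f i) e := by
  unfold extDatum
  split_ifs <;> rfl

/-- `extDatum` is measurable in the free-link data (the datum being fixed). -/
theorem measurable_extDatum_apply (ϑ : Literature.MathematicalPhysics.QuantumLattice.ZdEdge 4 → (Fin 3 → ℝ))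
    (e : Literature.MathematicalPhysics.QuantumLattice.ZdEdge 4) :
    Measurable fun w : ColdFreeIdx H → (Fin 3 → ℝ) => extDatum ϑ w e := by
  unfold extDatum
  split_ifs
  · exact measurable_const
  · exact measurable_pi_apply _
  · exact measurable_const

/-! ## The scaled datum and its harmonic mean shift -/

/-- **The scaled datum** `ϑ'_c = √(2β) · ϑ_c` (Dirichlet units), colour by colour. -/
def sdat (β : ℝ) (ϑ : Fin 3 → (Literature.MathematicalPhysics.QuantumLattice.ZdEdge 4 → ℝ)) :
    Fin 3 → (Literature.MathematicalPhysics.QuantumLattice.ZdEdge 4 → ℝ) := fun c => Real.sqrt (2 * β) • ϑ c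

/-- `sdat β ϑ c e = √(2β) · ϑ c e`. -/
@[simp] theorem sdat_apply (β : ℝ) (ϑ : Fin 3 → (Literature.MathematicalPhysics.QuantumLattice.ZdEdge 4 → ℝ)) (c : Fin 3)
    (e : Literature.MathematicalPhysics.QuantumLattice.ZdEdge 4) : sdat β ϑ c e = Real.sqrt (2 * β) * ϑ c e := rfl

/-- The flat datum scales to the flat datum. -/
@[simp] theorem sdat_zero (β : ℝ) : sdat β (0 : Fin 3 → (Literature.MathematicalPhysics.QuantumLattice.ZdEdge 4 → ℝ)) = 0 := by
  funext c; simp [sdat]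

/-- The harmonic mean of the zero datum vanishes. -/
theorem mean_zero_dir (H : ℕ) :
    mean (fun e => e ∉ dirFreeEdges H) dirCorner (2 * H + 3) (0 : Literature.MathematicalPhysics.QuantumLattice.ZdEdge 4 → ℝ) = 0 := by
  have h := mean_smul (pin := fun e => e ∉ dirFreeEdges H) (a := dirCorner) (n := 2 * H + 3) (0 : ℝ)
    (0 : Literature.MathematicalPhysics.QuantumLattice.ZdEdge 4 → ℝ)
  rwa [zero_smul, zero_smul] at h

variable (H) in
/-- **The harmonic mean shift of the scaled datum**, as a colour triple of D1' variables: `(mean ϑ'_c)_c`. -/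
def meanT (β : ℝ) (ϑ : Fin 3 → (Literature.MathematicalPhysics.QuantumLattice.ZdEdge 4 → ℝ)) : TSpace H :=
  fun c => WithLp.toLp 2 (mean (fun e => e ∉ dirFreeEdges H) dirCorner (2 * H + 3) (sdat β ϑ c))

/-- `meanT` of the flat datum vanishes. -/
@[simp] theorem meanT_zero (β : ℝ) : meanT H β (0 : Fin 3 → (Literature.MathematicalPhysics.QuantumLattice.ZdEdge 4 → ℝ)) = 0 := by
  funext c
  simp only [meanT, sdat_zero, Pi.zero_apply, mean_zero_dir]
  rfl

/-- Reading a component of `meanT`. -/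
theorem meanT_apply (β : ℝ) (ϑ : Fin 3 → (Literature.MathematicalPhysics.QuantumLattice.ZdEdge 4 → ℝ)) (c : Fin 3) :
    WithLp.ofLp (meanT H β ϑ c) = mean (fun e => e ∉ dirFreeEdges H) dirCorner (2 * H + 3) (sdat β ϑ c) := rfl

/-- Translation by a fixed colour triple is measurable on `TSpace H` (componentwise). -/
theorem measurable_add_const_TSpace (m : TSpace H) : Measurable fun t : TSpace H => t + m := by
  refine measurable_pi_lambda _ fun c => ?_
  change Measurable fun t : TSpace H => t c + m c
  exact (measurable_pi_apply c).add_const _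

/-! ## The chart configuration with datum -/

/-- **The chart configuration of free-link chart data `w` with datum `ϑ`**: every link of `ℤ⁴` is the gnomonic chart point
`P(1, extDatum ϑᵀ w e)` (free links `P(1, w_e)`, forest links `1`, exterior links `P(1, ϑ_e)`); the ϑ-twin of `chartCfg w`. -/
def chartCfgD (ϑ : Fin 3 → (Literature.MathematicalPhysics.QuantumLattice.ZdEdge 4 → ℝ)) (w : ColdFreeIdx H → (Fin 3 → ℝ)) :
    LGConfig 4 (Matrix.specialUnitaryGroup (Fin 2) ℂ) :=
  fun e => gnomonicChart (extDatum (fun e c => ϑ c e) w e)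

/-- At the flat datum, `chartCfgD 0 = chartCfg`. -/
@[simp] theorem chartCfgD_zero : chartCfgD (H := H) (0 : Fin 3 → (Literature.MathematicalPhysics.QuantumLattice.ZdEdge 4 → ℝ)) = chartCfg := by
  funext w e
  have h0 : (fun (e : Literature.MathematicalPhysics.QuantumLattice.ZdEdge 4) (c : Fin 3) =>
      (0 : Fin 3 → (Literature.MathematicalPhysics.QuantumLattice.ZdEdge 4 → ℝ)) c e) = 0 := rfl
  rw [chartCfgD, h0, extDatum_zero]
  rfl

/-- Off the cold box `chartCfgD ϑ w` is the chart point of the datum. -/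
theorem chartCfgD_of_not_mem (ϑ : Fin 3 → (Literature.MathematicalPhysics.QuantumLattice.ZdEdge 4 → ℝ)) (w : ColdFreeIdx H → (Fin 3 → ℝ))
    {e : Literature.MathematicalPhysics.QuantumLattice.ZdEdge 4} (he : e ∉ boxEdges 4 (2 * H + 1)) :
    chartCfgD ϑ w e = gnomonicChart (fun c => ϑ c e) := by
  rw [chartCfgD, extDatum_of_not_mem _ _ he]

/-- On the temporal forest `chartCfgD ϑ w` is `1`. -/
theorem chartCfgD_of_forest (ϑ : Fin 3 → (Literature.MathematicalPhysics.QuantumLattice.ZdEdge 4 → ℝ)) (w : ColdFreeIdx H → (Fin 3 → ℝ))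
    {x : Site 4} (hx : ∀ k : Fin 4, 1 ≤ x k ∧ x k + 1 ≤ 2 * (H : ℤ)) : chartCfgD ϑ w (x, 0) = 1 := by
  rw [chartCfgD, extDatum_of_forest _ _ hx, gnomonicChart_zero]

/-- On a free link `chartCfgD ϑ w` is the chart point `P(1, w_e)`. -/
theorem chartCfgD_apply_free (ϑ : Fin 3 → (Literature.MathematicalPhysics.QuantumLattice.ZdEdge 4 → ℝ)) (w : ColdFreeIdx H → (Fin 3 → ℝ))
    (e : ColdFreeIdx H) : chartCfgD ϑ w e.1.1 = gnomonicChart (w e) := by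
  rw [chartCfgD, extDatum_apply_free]

/-- **Gluing gauge-fixed free links into the datum gives the chart configuration with datum**: if the exterior configuration `W` is
`P(1, ϑ_e)` off the cold box, then `glueWith Λ (coldExt₁ (P(1, w_·))) W = chartCfgD ϑ w`. -/
theorem glueWith_coldExt₁_gnomonicChart (ϑ : Fin 3 → (Literature.MathematicalPhysics.QuantumLattice.ZdEdge 4 → ℝ))
    {W : LGConfig 4 (Matrix.specialUnitaryGroup (Fin 2) ℂ)}
    (hW : ∀ e, e ∉ boxEdges 4 (2 * H + 1) → W e = gnomonicChart (fun c => ϑ c e)) (w : ColdFreeIdx H → (Fin 3 → ℝ)) :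
    Literature.Probability.LatticeModels.glueWith (boxEdges 4 (2 * H + 1)) (coldExt₁ (fun e => gnomonicChart (w e))) W =
      chartCfgD ϑ w := by
  funext e
  by_cases he : e ∈ boxEdges 4 (2 * H + 1)
  · have h1 : chartCfgD ϑ w e = chartCfg w e := by rw [chartCfgD, extDatum_of_mem _ _ he]; rfl
    have h2 := coldExt_apply_mem (coldExt₁ (fun e => gnomonicChart (w e))) ⟨e, he⟩
    rw [coldExt_coldExt₁_gnomonicChart] at h2
    rw [Literature.Probability.LatticeModels.glueWith_apply_mem _ _ _ he, h1, ← h2]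
  · rw [Literature.Probability.LatticeModels.glueWith_apply_not_mem _ _ _ he, hW e he, chartCfgD_of_not_mem _ _ he]

/-- `chartCfgD ϑ` is measurable in the free-link data. -/
theorem measurable_chartCfgD (ϑ : Fin 3 → (Literature.MathematicalPhysics.QuantumLattice.ZdEdge 4 → ℝ)) :
    Measurable (chartCfgD (H := H) ϑ) :=
  measurable_pi_lambda _ fun e => measurable_gnomonicChart.comp (measurable_extDatum_apply _ e)

variable (H) in
/-- **The chart configuration with datum** of the CENTRED colour triple `t`: every link of `ℤ⁴` is the gnomonic chart point of
`extDatum ϑ ((t + μ')/√(2β))`, i.e. free links `P(1, (t + μ')_e/√(2β))`, forest links `1`, exterior links `P(1, ϑ_e)`: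
`cfgTD H β ϑ t = chartCfgD ϑ (unscaleT H β (t + meanT H β ϑ))`. -/
def cfgTD (β : ℝ) (ϑ : Fin 3 → (Literature.MathematicalPhysics.QuantumLattice.ZdEdge 4 → ℝ)) (t : TSpace H) :
    LGConfig 4 (Matrix.specialUnitaryGroup (Fin 2) ℂ) :=
  chartCfgD ϑ (unscaleT H β (t + meanT H β ϑ))

/-- `cfgTD` through `chartCfgD` (definitional). -/
theorem cfgTD_eq_chartCfgD (β : ℝ) (ϑ : Fin 3 → (Literature.MathematicalPhysics.QuantumLattice.ZdEdge 4 → ℝ)) (t : TSpace H) :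
    cfgTD H β ϑ t = chartCfgD ϑ (unscaleT H β (t + meanT H β ϑ)) := rfl

/-- `cfgTD` unfolded at an edge (definitional). -/
theorem cfgTD_apply (β : ℝ) (ϑ : Fin 3 → (Literature.MathematicalPhysics.QuantumLattice.ZdEdge 4 → ℝ)) (t : TSpace H)
    (e : Literature.MathematicalPhysics.QuantumLattice.ZdEdge 4) :
    cfgTD H β ϑ t e = gnomonicChart (extDatum (fun e c => ϑ c e) (unscaleT H β (t + meanT H β ϑ)) e) := rfl

/-- **At the flat datum the chart configuration with datum is the flat one**: `cfgTD H β 0 = cfgT H β`. -/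
@[simp] theorem cfgTD_zero (β : ℝ) : cfgTD H β (0 : Fin 3 → (Literature.MathematicalPhysics.QuantumLattice.ZdEdge 4 → ℝ)) = cfgT H β := by
  funext t e
  rw [cfgTD_apply, meanT_zero, add_zero]
  have h0 : (fun (e : Literature.MathematicalPhysics.QuantumLattice.ZdEdge 4) (c : Fin 3) =>
      (0 : Fin 3 → (Literature.MathematicalPhysics.QuantumLattice.ZdEdge 4 → ℝ)) c e) = 0 := rfl
  rw [h0, extDatum_zero]
  rfl

/-- Off the cold box the chart configuration with datum is the chart point of the datum. -/
theorem cfgTD_of_not_mem (β : ℝ) (ϑ : Fin 3 → (Literature.MathematicalPhysics.QuantumLattice.ZdEdge 4 → ℝ)) (t : TSpace H)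
    {e : Literature.MathematicalPhysics.QuantumLattice.ZdEdge 4} (he : e ∉ boxEdges 4 (2 * H + 1)) :
    cfgTD H β ϑ t e = gnomonicChart (fun c => ϑ c e) := by
  rw [cfgTD_apply, extDatum_of_not_mem _ _ he]

/-- On the temporal forest the chart configuration with datum is `1`. -/
theorem cfgTD_of_forest (β : ℝ) (ϑ : Fin 3 → (Literature.MathematicalPhysics.QuantumLattice.ZdEdge 4 → ℝ)) (t : TSpace H)
    {x : Site 4} (hx : ∀ k : Fin 4, 1 ≤ x k ∧ x k + 1 ≤ 2 * (H : ℤ)) : cfgTD H β ϑ t (x, 0) = 1 := by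
  rw [cfgTD_apply, extDatum_of_forest _ _ hx, gnomonicChart_zero]

/-- On a free link the chart configuration with datum is the chart point of the shifted, unscaled variable. -/
theorem cfgTD_apply_free (β : ℝ) (ϑ : Fin 3 → (Literature.MathematicalPhysics.QuantumLattice.ZdEdge 4 → ℝ)) (t : TSpace H)
    (e : ColdFreeIdx H) : cfgTD H β ϑ t e.1.1 = gnomonicChart (unscaleT H β (t + meanT H β ϑ) e) := by
  rw [cfgTD_apply, extDatum_apply_free]

/-- `cfgTD` is measurable in the centred variables. -/
theorem measurable_cfgTD (β : ℝ) (ϑ : Fin 3 → (Literature.MathematicalPhysics.QuantumLattice.ZdEdge 4 → ℝ)) :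
    Measurable (cfgTD H β ϑ) :=
  (measurable_chartCfgD ϑ).comp ((measurable_unscaleT β).comp (measurable_add_const_TSpace _))

/-! ## The quadratic surrogate, the small-field event and the tilt, with datum -/

variable (H) in
/-- **The quadratic surrogate with datum** of `β·cost_p`: `½ Σ_c sCirc(glue ϑ'_c (mean ϑ'_c + t_c))(p)²` (the scaled datum `ϑ' = sdat β ϑ`
pinned on the enlarged box, the harmonic background plus the fluctuation on the free edges). -/
def qObsD (β : ℝ) (ϑ : Fin 3 → (Literature.MathematicalPhysics.QuantumLattice.ZdEdge 4 → ℝ)) (p : Plaq 4) (t : TSpace H) : ℝ :=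
  1 / 2 * ∑ c, (sCirc (glue (pin := fun e => e ∉ dirFreeEdges H) dirCorner (2 * H + 3) (sdat β ϑ c)
    (mean (fun e => e ∉ dirFreeEdges H) dirCorner (2 * H + 3) (sdat β ϑ c) + WithLp.ofLp (t c))) p) ^ 2

/-- `qObsD` is nonnegative. -/
theorem qObsD_nonneg (β : ℝ) (ϑ : Fin 3 → (Literature.MathematicalPhysics.QuantumLattice.ZdEdge 4 → ℝ)) (p : Plaq 4) (t : TSpace H) :
    0 ≤ qObsD H β ϑ p t := by
  unfold qObsD; positivity

/-- **At the flat datum the surrogate with datum is the flat one**: `qObsD H β 0 = qObs H`. -/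
@[simp] theorem qObsD_zero (β : ℝ) : qObsD H β (0 : Fin 3 → (Literature.MathematicalPhysics.QuantumLattice.ZdEdge 4 → ℝ)) = qObs H := by
  funext p t
  simp only [qObsD, qObs, sdat_zero, Pi.zero_apply, mean_zero_dir, zero_add, dirCirc_apply]

/-- The glued field of fixed datum is measurable in the free variables (indeed affine). -/
theorem measurable_sCirc_glue_add (θ : Literature.MathematicalPhysics.QuantumLattice.ZdEdge 4 → ℝ) (m : DirFree H → ℝ) (p : Plaq 4) :
    Measurable fun s : EuclideanSpace ℝ (DirFree H) =>
      sCirc (glue (pin := fun e => e ∉ dirFreeEdges H) dirCorner (2 * H + 3) θ (m + WithLp.ofLp s)) p := by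
  have hc : Measurable fun s : EuclideanSpace ℝ (DirFree H) => (WithLp.ofLp s : DirFree H → ℝ) :=
    (PiLp.continuous_ofLp 2 _).measurable
  have h : ∀ e : Literature.MathematicalPhysics.QuantumLattice.ZdEdge 4, Measurable fun s : EuclideanSpace ℝ (DirFree H) =>
      glue (pin := fun e => e ∉ dirFreeEdges H) dirCorner (2 * H + 3) θ (m + WithLp.ofLp s) e := by
    intro e
    unfold glue
    split_ifs
    · exact measurable_const
    · exact (measurable_pi_apply _).comp (measurable_const.add hc)
    · exact measurable_const
  unfold sCirc
  exact (((h _).add (h _)).sub (h _)).sub (h _)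

/-- `qObsD` is measurable. -/
theorem measurable_qObsD (β : ℝ) (ϑ : Fin 3 → (Literature.MathematicalPhysics.QuantumLattice.ZdEdge 4 → ℝ)) (p : Plaq 4) :
    Measurable (qObsD H β ϑ p) := by
  unfold qObsD
  exact measurable_const.mul (Finset.measurable_sum _ fun c _ =>
    ((measurable_sCirc_glue_add _ _ p).comp (measurable_pi_apply c)).pow_const 2)

variable (H) in
/-- **The small-field event read in the centred colour variables, with datum**: `cfgTD H β ϑ t ∈ coldGoodSet β ε H`. -/
def goodTD (β ε : ℝ) (ϑ : Fin 3 → (Literature.MathematicalPhysics.QuantumLattice.ZdEdge 4 → ℝ)) : Set (TSpace H) :=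
  {t | cfgTD H β ϑ t ∈ coldGoodSet β ε H}

/-- Membership in `goodTD` (definitional). -/
theorem mem_goodTD_iff (β ε : ℝ) (ϑ : Fin 3 → (Literature.MathematicalPhysics.QuantumLattice.ZdEdge 4 → ℝ)) (t : TSpace H) :
    t ∈ goodTD H β ε ϑ ↔ cfgTD H β ϑ t ∈ coldGoodSet β ε H := Iff.rfl

/-- At the flat datum, `goodTD = goodT`. -/
@[simp] theorem goodTD_zero (β ε : ℝ) : goodTD H β ε (0 : Fin 3 → (Literature.MathematicalPhysics.QuantumLattice.ZdEdge 4 → ℝ)) = goodT H β ε := by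
  ext t; simp only [mem_goodTD_iff, cfgTD_zero, goodT, Set.mem_setOf_eq]

/-- `goodTD` is measurable. -/
theorem measurableSet_goodTD (β ε : ℝ) (ϑ : Fin 3 → (Literature.MathematicalPhysics.QuantumLattice.ZdEdge 4 → ℝ)) :
    MeasurableSet (goodTD H β ε ϑ) :=
  measurable_cfgTD β ϑ (measurableSet_coldGoodSet β ε H)

variable (H) in
/-- **The tilt exponent with datum**: (quadratic surrogate minus `β`·cost, summed over the plaquettes touching the cold box) plus the
logarithm of the gnomonic Jacobian `Π_{e free} (1+|w_e|²)⁻²` of the free links, `w = (t + μ')/√(2β)`. -/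
def tiltWD (β : ℝ) (ϑ : Fin 3 → (Literature.MathematicalPhysics.QuantumLattice.ZdEdge 4 → ℝ)) (t : TSpace H) : ℝ :=
  (∑ q ∈ plaquettesTouching (boxEdges 4 (2 * H + 1)),
      (qObsD H β ϑ (q.1, q.2.1.1, q.2.1.2) t - β * plaqCostAt (fundamentalRep (Fin 2)) q.1 q.2.1.1 q.2.1.2 (cfgTD H β ϑ t))) +
    ∑ e : ColdFreeIdx H, Real.log (((1 + ∑ i, (unscaleT H β (t + meanT H β ϑ) e i) ^ 2)⁻¹) ^ 2)

/-- At the flat datum, `tiltWD = tiltW`. -/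
@[simp] theorem tiltWD_zero (β : ℝ) : tiltWD H β (0 : Fin 3 → (Literature.MathematicalPhysics.QuantumLattice.ZdEdge 4 → ℝ)) = tiltW H β := by
  funext t
  simp only [tiltWD, tiltW, qObsD_zero, cfgTD_zero, meanT_zero, add_zero]

/-- `tiltWD` is measurable. -/
theorem measurable_tiltWD (β : ℝ) (ϑ : Fin 3 → (Literature.MathematicalPhysics.QuantumLattice.ZdEdge 4 → ℝ)) :
    Measurable (tiltWD H β ϑ) := by
  unfold tiltWD
  refine (Finset.measurable_sum _ fun q _ => (measurable_qObsD β ϑ _).sub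
    (measurable_const.mul ((measurable_plaqCostAt _ _ _).comp (measurable_cfgTD β ϑ)))).add
    (Finset.measurable_sum _ fun e _ => Real.measurable_log.comp ?_)
  refine ((measurable_const.add (Finset.measurable_sum _ fun i _ => ?_)).inv).pow_const 2
  exact ((measurable_pi_apply i).comp ((measurable_pi_apply e).comp
    ((measurable_unscaleT β).comp (measurable_add_const_TSpace _)))).pow_const 2

end Summit.QuantumFields.YangMills.Theorems.WeakCouplingRates

end
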